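import Literature.AnabelianGeometry.EtaleTheta.Discharge.Sec2OrbitEmbeddingCoeff
import Literature.AnabelianGeometry.EtaleTheta.Discharge.Sec2OrbitEmbeddingRootClassesInhabited
import Literature.AnabelianGeometry.EtaleTheta.Discharge.Sec2ThetaOrbitTransportCalculusOfEmbedding
import Literature.AnabelianGeometry.EtaleTheta.TemperedRigidity
import HarnessLib

/-!
# [EtTh] Cor 2.8 (i) at the §1 model, read along an ARBITRARY automorphism `Γ` of `Π^tp_C` restricting to
# `Π^tp_X`: the transport of (root) classes is [EtTh] Thm 1.6's transport, and Cor 2.8 (i) UNPACKED to a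
# cocycle identity on `Π^tp_Ÿ̲̲` (proof-only support for GAP row G-w5d169-2, ROUTE 2)

Mochizuki, *The Étale Theta Function …* [EtTh], Publ. RIMS 45 (2009), §2: Prop 2.4 p.38, Def 2.7 p.41,
Cor 2.8 (i) p.42 ("`γ` … induces an automorphism of `Δ_Θ` … preserves the property that `η̲̈^{Θ,l·ℤ×μ₂}` be of
standard type — a property that determines this collection of classes up to multiplication by a root of unity
of order `l`"); §1 Thm 1.6 (ii)/(iii) p.24 ("the isomorphism of cohomology groups induced by `γ`").
Bib key `MochizukiEtTh2009`; locators = PRIMS PDF pages.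

Cell abc-iut, layer L2, seat abc-iut-w5-d118 (gen 5), GAP-LEDGER row **G-w5d169-2, ROUTE 2** (D-row
2026-08-26T10:28:05Z of abc-iut-w4-d041; L2-lead ROWS #14b R250). PROOF-ONLY (no `def`, no instance, no new
`Prop` fact). abc-iut-w6-d051's `Sec2OrbitEmbeddingOuterTransport` reads the transport of abc-iut-L2-t2's orbit
data `ThetaOrbitData.ofEmbedding ε hC hS` along the INNER automorphisms `γ_x = conj x` of `Π^tp_C`; Cor 2.8 (i)
quantifies over ALL topological automorphisms `Γ` of `Π^tp_C` (the extensions supplied by Prop 2.4). For such a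
`Γ` RESTRICTING to `Π^tp_X` through the embedding `ι` — `ι ∘ γ = Γ ∘ ι` for some `γ ∈ Aut_top(Π^tp_X)` — and a
theta companion `c` of `γ` (abc-iut-L2-t1's `ThetaSetting.ThetaCompanion`, Thm 1.6 (ii)):

* `pull_aut`, `pull_aut_symm` — `ι⁻¹ ∘ Γ^{±1} = γ^{±1} ∘ ι⁻¹` on `Π^tp_Ÿ` of `T`;
* `exists_inducesOnTheta_of_companion` — the automorphism `Γ_Θ := coeffOf ∘ γ^Θ ∘ coeffOf⁻¹` of the
  cyclotome `ι(toTheta⁻¹Δ_Θ)/ι(Ker toTheta) ≅ Δ_Θ` is INDUCED by `Γ` (`ThetaOrbitData.InducesOnTheta Γ Γ_Θ`) and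
  satisfies `Γ_Θ (coeffOf d) = coeffOf (γ^Θ d)`;
* `aut_transport_symm_apply` — on representatives the transport `ξ ↦ Γ_Θ ∘ ξ ∘ Γ⁻¹` of Cor 2.8 IS Thm 1.6 (iii)'s
  transport of cocycles: `Γ_Θ (F (Γ⁻¹ y)) = (transport of (transportCocycle c h f)) y` for `F = transport f`;
* **`exists_rep_transport_eq_mul_coboundary_of_cor28_i`** — Cor 2.8 (i) (the named fact F-0640
  `ThetaOrbitData.Cor28_i`, HYPOTHESIS `h28` at `ofEmbedding`, together with its standing hypotheses: standard
  type `IsStandard`, `Γ` permutes `Dtau`, `Γ` stabilises the Prop 2.4 tower) UNPACKED at the root class of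
  `η̈^Θ`: there are `σ₁ ∈ Π^tp_{X̲̲}`, cocycle representatives `f₀` of `η̈^Θ` and `f₁` of `σ₁·η̈^Θ`, and
  `d₀ ∈ Δ_Θ` with `γ^Θ ∘ f₀ ∘ γ⁻¹ = f₁ · ∂d₀` ON `Π^tp_Ÿ ∩ Π^tp_{X̲̲}` — the `l`-th power of "transport of
  `η̲̈^{Θ,l·ℤ×μ₂}` = twist by a root of unity of `η̲̈^{Θ,l·ℤ×μ₂}`", read through `coeffOf`
  (abc-iut-L2-t2's `coeffOf_injective` / `act_coeffOf` / `ofEmbedding_deltaTheta_comm`; inhabited root classes: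
  abc-iut-L2-t2/abc-iut-w6-d051's `rootClassOf_conj_nonempty`).
Consumer: abc-iut-w5-d118's `EtaleThetaDataOfSettingRootHypOfCor28i` (IUT side), which feeds this identity
into abc-iut-w4-d041's `EtaleThetaDataOfSetting.rootHyp_of_forall_extends_transport` (p436936).
HONEST FRAMING: [EtTh] is refereed; Cor 2.8 (i) / standard type / `Dtau`-stability are HYPOTHESES here;
statements about the TYPED interface only; no side is taken on [IUTchIII] Cor 3.12; typed ≠ proved.
-/

noncomputable section

namespace Literature.AnabelianGeometry.EtaleTheta

open Literature.AnabelianGeometry.SemiGraphs ThetaCovers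

universe u

namespace ThetaSetting.EtaleThetaData.DoubleUnderline.OrbitEmbedding

variable {p : ℕ} [Fact p.Prime] {D : ThetaSetting p} {E : D.EtaleThetaData} {l : ℕ}
  {C : E.DoubleUnderline l} {T : TemperedCoverData.{u} l} (ε : C.OrbitEmbedding T)
  {Γ : T.Gtp ≃ₜ* T.Gtp} {γ : D.PiTemp ≃ₜ* D.PiTemp}

/-! ### Bookkeeping: `ι⁻¹ ∘ Γ = γ ∘ ι⁻¹` on `Π^tp_Ÿ` -/

/-- `pull (Γ y) = γ (pull y)` when `ι ∘ γ = Γ ∘ ι`. [cite: MochizukiEtTh2009, Cor 2.8(i) p.42] -/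
theorem pull_aut (hα : ∀ g, ε.ι (γ g) = Γ (ε.ι g)) (y : ↥T.PiYddtp) (h : Γ (y : T.Gtp) ∈ T.PiYddtp) :
    (ε.pull ⟨Γ (y : T.Gtp), h⟩ : D.PiTemp) = γ (ε.pull y : D.PiTemp) := by
  apply ε.injective_ι
  rw [ε.ι_pull, hα, ε.ι_pull]

/-- `pull (Γ⁻¹ y) = γ⁻¹ (pull y)` when `ι ∘ γ = Γ ∘ ι`. [cite: MochizukiEtTh2009, Cor 2.8(i) p.42] -/
theorem pull_aut_symm (hα : ∀ g, ε.ι (γ g) = Γ (ε.ι g)) (y : ↥T.PiYddtp)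
    (h : Γ.symm (y : T.Gtp) ∈ T.PiYddtp) :
    (ε.pull ⟨Γ.symm (y : T.Gtp), h⟩ : D.PiTemp) = γ.symm (ε.pull y : D.PiTemp) := by
  apply γ.injective
  apply ε.injective_ι
  rw [hα, ε.ι_pull, ContinuousMulEquiv.apply_symm_apply, ContinuousMulEquiv.apply_symm_apply, ε.ι_pull]

/-- `ι γ⁻¹ g = Γ⁻¹ ι g`. [cite: MochizukiEtTh2009, Cor 2.8(i) p.42] -/
theorem ι_aut_symm (hα : ∀ g, ε.ι (γ g) = Γ (ε.ι g)) (g : D.PiTemp) :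
    ε.ι (γ.symm g) = Γ.symm (ε.ι g) := by
  apply Γ.injective
  rw [← hα, ContinuousMulEquiv.apply_symm_apply, ContinuousMulEquiv.apply_symm_apply]

/-! ### The induced automorphism of the cyclotome from a theta companion -/

/-- `toTheta (γ g) = γ^Θ (toTheta g)` (the companion square). [cite: MochizukiEtTh2009, Thm 1.6 (ii) p.24] -/
theorem toTheta_aut (c : ThetaSetting.ThetaCompanion γ) (g : D.PiTemp) :
    D.toTheta (γ g) = c.thetaIso (D.toTheta g) := c.comm g

/-- `toTheta (γ⁻¹ g) = (γ^Θ)⁻¹ (toTheta g)`. [cite: MochizukiEtTh2009, Thm 1.6 (ii) p.24] -/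
theorem toTheta_aut_symm (c : ThetaSetting.ThetaCompanion γ) (g : D.PiTemp) :
    D.toTheta (γ.symm g) = c.thetaIso.symm (D.toTheta g) := by
  apply c.thetaIso.injective
  rw [← toTheta_aut c, ContinuousMulEquiv.apply_symm_apply, ContinuousMulEquiv.apply_symm_apply]

/-- `(γ^Θ)⁻¹` preserves `Δ_Θ`. [cite: MochizukiEtTh2009, Thm 1.6 (ii) p.24] -/
theorem thetaIso_symm_mem (c : ThetaSetting.ThetaCompanion γ) (d : ↥D.DeltaTheta) :
    c.thetaIso.symm (d : D.GtpTheta) ∈ D.DeltaTheta := by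
  have hd : (d : D.GtpTheta) ∈ D.DeltaTheta.map c.thetaIso.toMulEquiv.toMonoidHom := by
    rw [c.map_deltaTheta]; exact d.2
  obtain ⟨d', hd', hdd⟩ := hd
  have : c.thetaIso.symm (d : D.GtpTheta) = d' := by
    rw [← hdd]; exact c.thetaIso.symm_apply_apply d'
  rw [this]; exact hd'

/-- **`Γ` stabilises `top = ι(toTheta⁻¹Δ_Θ)`** when `ι ∘ γ = Γ ∘ ι` and `γ` has a theta companion.
[cite: MochizukiEtTh2009, Cor 2.8(i) p.42] -/
theorem map_top_eq_of_companion (hα : ∀ g, ε.ι (γ g) = Γ (ε.ι g)) (c : ThetaSetting.ThetaCompanion γ) :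
    ε.top.map Γ.toMulEquiv.toMonoidHom = ε.top := by
  ext t
  constructor
  · rintro ⟨_, ⟨g, hg, rfl⟩, rfl⟩
    refine ⟨γ g, ?_, hα g⟩
    show D.toTheta (γ g) ∈ D.DeltaTheta
    rw [toTheta_aut c]
    exact c.apply_mem ⟨_, hg⟩
  · rintro ⟨g, hg, rfl⟩
    refine ⟨ε.ι (γ.symm g), ⟨γ.symm g, ?_, rfl⟩, ?_⟩
    · show D.toTheta (γ.symm g) ∈ D.DeltaTheta
      rw [toTheta_aut_symm c]
      exact thetaIso_symm_mem c ⟨_, hg⟩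
    · show Γ (ε.ι (γ.symm g)) = ε.ι g
      rw [ε.ι_aut_symm hα, ContinuousMulEquiv.apply_symm_apply]

/-- **The automorphism of the cyclotome induced by `Γ`, from a theta companion**: there is
`Γ_Θ ∈ Aut(ι(toTheta⁻¹Δ_Θ)/ι(Ker toTheta))` INDUCED by `Γ` (`InducesOnTheta Γ Γ_Θ` for the orbit data
`ofEmbedding`) with `Γ_Θ ∘ coeffOf = coeffOf ∘ γ^Θ` on `Δ_Θ` ("`γ` induces an automorphism of `Δ_Θ`").
[cite: MochizukiEtTh2009, Cor 2.8(i) p.42] -/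
theorem exists_inducesOnTheta_of_companion (hC : D.Compat) (hS : D.Sec2Hyps)
    (hα : ∀ g, ε.ι (γ g) = Γ (ε.ι g)) (c : ThetaSetting.ThetaCompanion γ) :
    ∃ ΓΘ : (ThetaOrbitData.ofEmbedding ε hC hS).DeltaTheta ≃* (ThetaOrbitData.ofEmbedding ε hC hS).DeltaTheta,
      (ThetaOrbitData.ofEmbedding ε hC hS).InducesOnTheta Γ ΓΘ ∧
      ∀ d : ↥D.DeltaTheta, ΓΘ (ε.coeffOf d) = ε.coeffOf ⟨c.thetaIso d, c.apply_mem d⟩ := by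
  haveI : ε.bot.Normal := ε.normal_bot
  obtain ⟨e, he⟩ := ε.exists_mulEquiv_coeffOf
  -- `γ^Θ` restricted to `Δ_Θ`
  let βΔ : ↥D.DeltaTheta ≃* ↥D.DeltaTheta :=
    (c.thetaIso.toMulEquiv.subgroupMap D.DeltaTheta).trans (MulEquiv.subgroupCongr c.map_deltaTheta)
  have hβΔ : ∀ d : ↥D.DeltaTheta, (βΔ d : D.GtpTheta) = c.thetaIso d := fun d => rfl
  refine ⟨e.symm.trans (βΔ.trans e), ?_, fun d => ?_⟩
  · refine ⟨ε.map_top_eq_of_companion hα c, fun t => ?_⟩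
    obtain ⟨g, hg, hgt⟩ := Subgroup.mem_map.1 (show (t : T.Gtp) ∈ ε.top from t.2)
    have hd : D.toTheta g ∈ D.DeltaTheta := hg
    have ht : (QuotientGroup.mk t : (ThetaOrbitData.ofEmbedding ε hC hS).DeltaTheta) = ε.coeffOf ⟨_, hd⟩ := by
      have ht' : t = ⟨ε.ι g, hgt ▸ t.2⟩ := Subtype.ext hgt.symm
      rw [ht']
      exact (ε.coeffOf_eq_mk rfl _).symm
    rw [ht]
    show e (βΔ (e.symm (ε.coeffOf ⟨_, hd⟩))) = _
    rw [← he, e.symm_apply_apply, he]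
    have hmem : ε.ι (γ g) ∈ ε.top := by
      rw [hα, hgt]; exact (ε.map_top_eq_of_companion hα c).le ⟨t, t.2, rfl⟩
    rw [ε.coeffOf_eq_mk (d := βΔ ⟨_, hd⟩) (g := γ g) (by rw [toTheta_aut c, hβΔ]) hmem]
    congr 1
    apply Subtype.ext
    show ε.ι (γ g) = Γ t
    rw [hα, hgt]
  · show e (βΔ (e.symm (ε.coeffOf d))) = _
    rw [← he, e.symm_apply_apply, he]
    exact congrArg ε.coeffOf (Subtype.ext (hβΔ d))

/-! ### On representatives: the transport of Cor 2.8 is the transport of Thm 1.6 -/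

/-- **`Γ_Θ (F (Γ⁻¹ y)) = (transport (γ^Θ ∘ f ∘ γ⁻¹)) y`** for `F = transport f` (a cocycle `f` on `Π^tp_Ÿ`), `Γ_Θ` with
`Γ_Θ ∘ coeffOf = coeffOf ∘ γ^Θ`, and `γ(Π^tp_Ÿ) = Π^tp_Ÿ` (Thm 1.6 (i)): on representatives, the transport
`ξ ↦ Γ_Θ ∘ ξ ∘ Γ⁻¹` of the orbit data is Thm 1.6 (iii)'s `transportCocycle c h`.
[cite: MochizukiEtTh2009, Thm 1.6 (iii) p.24] -/
theorem aut_transport_symm_apply [ε.bot.Normal] (hα : ∀ g, ε.ι (γ g) = Γ (ε.ι g))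
    (h : ThetaSetting.Thm16i γ) (c : ThetaSetting.ThetaCompanion γ) (ΓΘ : ε.Coeff ≃* ε.Coeff)
    (hΘ : ∀ d : ↥D.DeltaTheta, ΓΘ (ε.coeffOf d) = ε.coeffOf ⟨c.thetaIso d, c.apply_mem d⟩)
    (f : ↥(contCocycles D.toTheta D.DeltaTheta D.GtpYdd)) (y : ↥T.PiYddtp)
    (hy : Γ.symm (y : T.Gtp) ∈ T.PiYddtp) :
    ΓΘ (ε.transport f.1 ⟨_, hy⟩) = ε.transport (ThetaSetting.transportCocycle c h f).1 y := by
  have hAB : ε.pull ⟨_, hy⟩ = ⟨γ.toMulEquiv.symm (ε.pull y : D.PiTemp), ThetaSetting.symm_mem_GtpYdd h _⟩ :=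
    Subtype.ext (ε.pull_aut_symm hα y hy)
  show ΓΘ (ε.coeffOf (f.1 (ε.pull ⟨_, hy⟩))) = ε.coeffOf ((ThetaSetting.transportCocycle c h f).1 (ε.pull y))
  rw [hΘ, hAB]
  rfl

/-! ### Cor 2.8 (i) unpacked at the root class of `η̈^Θ` -/

/-- `Γ⁻¹` stabilises a subgroup stabilised by `Γ` (the Prop 2.4 stabilisation read for the inverse).
[cite: MochizukiEtTh2009, Prop 2.4 p.38] -/
theorem map_symm_eq_of_map_eq {K : Subgroup T.Gtp} (hK : K.map Γ.toMulEquiv.toMonoidHom = K) :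
    K.map Γ.symm.toMulEquiv.toMonoidHom = K :=
  ThetaOrbitData.map_symm_eq K hK

/-- `Γ` stabilises `Π^tp_{Ÿ̲̲} = Π^tp_Ÿ ∩ Π^tp_{X̲̲}` of `T` if it stabilises both. [cite: MochizukiEtTh2009, Def 2.7 p.41] -/
theorem map_PiYdduu_eq (hY : T.PiYddtp.map Γ.toMulEquiv.toMonoidHom = T.PiYddtp)
    (hU : (T.tp T.PiXuu).map Γ.toMulEquiv.toMonoidHom = T.tp T.PiXuu) :
    (T.PiYddtp ⊓ T.tp T.PiXuu).map Γ.toMulEquiv.toMonoidHom = T.PiYddtp ⊓ T.tp T.PiXuu := by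
  rw [Subgroup.map_inf _ _ _ Γ.injective, hY, hU]

/-- **Cor 2.8 (i) UNPACKED at the root class of `η̈^Θ`**: let `Γ ∈ Aut_top(Π^tp_C)` restrict to `γ ∈ Aut_top(Π^tp_X)`
through `ι` (`ι ∘ γ = Γ ∘ ι`), with `γ(Π^tp_Ÿ) = Π^tp_Ÿ` and a theta companion `c`; assume `Γ` stabilises the Prop 2.4
tower of `T`, permutes `Dtau`, that `η̈^{Θ,ℤ×μ₂}` is of standard type and Cor 2.8 (i) (`Cor28_i`, named fact F-0640 —
a HYPOTHESIS here) for the orbit data `ofEmbedding ε hC hS`.  Then there are `σ₁ ∈ Π^tp_{X̲̲}`, cocycle representatives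
`f₀` of `η̈^Θ` and `f₁` of `σ₁·η̈^Θ`, and `d₀ ∈ Δ_Θ` such that ON `Π^tp_Ÿ ∩ Π^tp_{X̲̲}`
`γ^Θ(f₀(γ⁻¹ x)) = f₁(x) · (x^Θ d₀ (x^Θ)⁻¹) · d₀⁻¹` — the `l`-th power of the conclusion
"`η̲̈^{Θ,l·ℤ×μ₂}` is carried to its twist by a root of unity of order `l`" of Cor 2.8 (i) applied to `Γ⁻¹`, read on
`Δ_Θ` through `coeffOf`. [cite: MochizukiEtTh2009, Cor 2.8(i) p.42] -/
theorem exists_rep_transport_eq_mul_coboundary_of_cor28_i [hN : D.GtpYdd.Normal] (hC : D.Compat) (hS : D.Sec2Hyps)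
    (hα : ∀ g, ε.ι (γ g) = Γ (ε.ι g)) (h : ThetaSetting.Thm16i γ) (c : ThetaSetting.ThetaCompanion γ)
    (htower : ∀ S ∈ T.tower, S.map Γ.toMulEquiv.toMonoidHom = S)
    (hDtau : ∀ Dt ∈ (ThetaOrbitData.ofEmbedding ε hC hS).Dtau,
      Dt.map Γ.toMulEquiv.toMonoidHom ∈ (ThetaOrbitData.ofEmbedding ε hC hS).Dtau)
    (hstd : (ThetaOrbitData.ofEmbedding ε hC hS).IsStandard)
    (h28 : (ThetaOrbitData.ofEmbedding ε hC hS).Cor28_i) :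
    ∃ σ₁ ∈ C.Huu, ∃ (f₀ f₁ : ↥(contCocycles D.toTheta D.DeltaTheta D.GtpYdd)) (d₀ : ↥D.DeltaTheta),
      ContH1.mk f₀.1 f₀.2 = E.etaDd ∧
      ContH1.mk f₁.1 f₁.2 = ContH1.conj D.toTheta D.DeltaTheta σ₁ E.etaDd ∧
      ∀ x : ↥D.GtpYdd, (x : D.PiTemp) ∈ C.Huu →
        (ThetaSetting.transportCocycle c h f₀).1 x =
          f₁.1 x * (MulAut.conjNormal (D.toTheta (x : D.PiTemp)) d₀ * d₀⁻¹) := by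
  haveI hb : ε.bot.Normal := ε.normal_bot
  obtain ⟨ΓΘ, hind, hΓΘ⟩ := ε.exists_inducesOnTheta_of_companion hC hS hα c
  obtain ⟨e, he⟩ := ε.exists_mulEquiv_coeffOf
  -- tower bookkeeping
  have hU : (T.tp T.PiXuu).map Γ.toMulEquiv.toMonoidHom = T.tp T.PiXuu :=
    htower _ (by simp [TemperedCoverData.tower])
  have hY : T.PiYddtp.map Γ.toMulEquiv.toMonoidHom = T.PiYddtp :=
    htower _ (by simp [TemperedCoverData.tower])
  have hY' : T.PiYddtp.map Γ.symm.toMulEquiv.toMonoidHom = T.PiYddtp := map_symm_eq_of_map_eq hY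
  have hYuu : (T.PiYddtp ⊓ T.tp T.PiXuu).map Γ.toMulEquiv.toMonoidHom = T.PiYddtp ⊓ T.tp T.PiXuu :=
    map_PiYdduu_eq hY hU
  have hYuu' : (T.PiYddtp ⊓ T.tp T.PiXuu).map Γ.symm.toMulEquiv.toMonoidHom = T.PiYddtp ⊓ T.tp T.PiXuu :=
    map_symm_eq_of_map_eq hYuu
  have htower' : ∀ S ∈ T.tower, S.map Γ.symm.toMulEquiv.toMonoidHom = S := fun S hS' =>
    map_symm_eq_of_map_eq (htower S hS')
  have hDtau' : ∀ Dt ∈ (ThetaOrbitData.ofEmbedding ε hC hS).Dtau,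
      Dt.map Γ.symm.toMulEquiv.toMonoidHom ∈ (ThetaOrbitData.ofEmbedding ε hC hS).Dtau :=
    (ThetaOrbitData.ofEmbedding ε hC hS).map_symm_mem_Dtau_of_finite
      (ThetaOrbitData.ofEmbedding_Dtau_finite ε hC hS) hDtau
  -- Cor 2.8 (i), second conjunct, for `(Γ⁻¹, Γ_Θ⁻¹)`
  obtain ⟨κ, -, -, ⟨d, hd⟩, hEq⟩ :=
    (h28 hstd Γ.symm ΓΘ.symm hind.symm hDtau' hY' hYuu').2.1 htower'
  -- the root class of `η̈^Θ` is a member of `η̲̈^{Θ,l·ℤ×μ₂}`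
  have hc₀ : ε.rootClassOf E.etaDd ∈ (ThetaOrbitData.ofEmbedding ε hC hS).rootLZMu2 := by
    refine ⟨1, C.Huu.one_mem, ?_⟩
    rw [ContH1.conj_one_apply]
  -- its transport lies in the twist of `η̲̈^{Θ,l·ℤ×μ₂}` by `κ`
  have hmemT : (fun ξ : ↥(T.PiYddtp ⊓ T.tp T.PiXuu) → (ThetaOrbitData.ofEmbedding ε hC hS).DeltaTheta =>
      fun g : ↥(T.PiYddtp ⊓ T.tp T.PiXuu) =>
        ΓΘ.symm.symm (ξ ⟨Γ.symm (g : T.Gtp), hYuu'.le (Subgroup.mem_map.mpr ⟨g, g.2, rfl⟩)⟩)) ''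
        ε.rootClassOf E.etaDd ∈ (ThetaOrbitData.ofEmbedding ε hC hS).twist _ κ
          (ThetaOrbitData.ofEmbedding ε hC hS).rootLZMu2 := by
    rw [← hEq]
    exact Set.mem_image_of_mem _ hc₀
  obtain ⟨c₁, ⟨σ₁, hσ₁, rfl⟩, hT⟩ := hmemT
  -- an `l`-th root of (a representative of) `σ₁·η̈^Θ` … (read with values in the cyclotome of `ofEmbedding`)
  obtain ⟨ξ₁, hξ₁⟩ :
      ∃ ξ : ↥(T.PiYddtp ⊓ T.tp T.PiXuu) → (ThetaOrbitData.ofEmbedding ε hC hS).DeltaTheta,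
        ξ ∈ ε.rootClassOf (ContH1.conj D.toTheta D.DeltaTheta σ₁ E.etaDd) :=
    ε.rootClassOf_conj_nonempty hC hS hσ₁
  -- … twisted by `κ`, is the transport of an `l`-th root `ξ₀` of (a representative of) `η̈^Θ`
  have hmem₁ : (fun g : ↥(T.PiYddtp ⊓ T.tp T.PiXuu) => ξ₁ g * κ g) ∈
      (fun ξ : ↥(T.PiYddtp ⊓ T.tp T.PiXuu) → (ThetaOrbitData.ofEmbedding ε hC hS).DeltaTheta =>
        fun g : ↥(T.PiYddtp ⊓ T.tp T.PiXuu) =>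
          ΓΘ.symm.symm (ξ ⟨Γ.symm (g : T.Gtp), hYuu'.le (Subgroup.mem_map.mpr ⟨g, g.2, rfl⟩)⟩)) ''
          ε.rootClassOf E.etaDd := by
    rw [← hT]
    exact Set.mem_image_of_mem _ hξ₁
  obtain ⟨ξ₀, hξ₀, hξ⟩ := hmem₁
  obtain ⟨F₁, ⟨f₁, hf₁, rfl⟩, hpow₁⟩ := hξ₁
  obtain ⟨F₀, ⟨f₀, hf₀, rfl⟩, hpow₀⟩ := hξ₀
  obtain ⟨d₀, hd₀⟩ := ε.coeffOf_surjective d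
  refine ⟨σ₁, hσ₁, f₀, f₁, d₀, hf₀, hf₁, fun x hx => ?_⟩
  -- evaluate at `ι x ∈ Π^tp_Ÿ̲̲` of `T`
  have hgY : ε.ι (x : D.PiTemp) ∈ T.PiYddtp := ε.map_GtpYdd.le ⟨x, x.2, rfl⟩
  have hgU : ε.ι (x : D.PiTemp) ∈ T.tp T.PiXuu := ε.map_Huu.le ⟨x, hx, rfl⟩
  have hpull : ε.pull ⟨ε.ι (x : D.PiTemp), hgY⟩ = x := ε.pull_ι x
  have hyY : Γ.symm (ε.ι (x : D.PiTemp)) ∈ T.PiYddtp :=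
    hY'.le (Subgroup.mem_map.mpr ⟨ε.ι (x : D.PiTemp), hgY, rfl⟩)
  have hyU : Γ.symm (ε.ι (x : D.PiTemp)) ∈ T.PiYddtp ⊓ T.tp T.PiXuu :=
    hYuu'.le (Subgroup.mem_map.mpr ⟨ε.ι (x : D.PiTemp), ⟨hgY, hgU⟩, rfl⟩)
  have hcomm := ThetaOrbitData.ofEmbedding_deltaTheta_comm ε hC hS
  have hξg : ΓΘ (ξ₀ ⟨Γ.symm (ε.ι (x : D.PiTemp)), hyU⟩) =
      ξ₁ ⟨ε.ι (x : D.PiTemp), hgY, hgU⟩ * κ (ε.ι (x : D.PiTemp)) := by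
    have := congrFun hξ ⟨ε.ι (x : D.PiTemp), hgY, hgU⟩
    simpa only [MulEquiv.symm_symm] using this
  -- the computation, in the cyclotome of `ofEmbedding`
  obtain ⟨A₀, hA₀⟩ : ∃ A : (ThetaOrbitData.ofEmbedding ε hC hS).DeltaTheta,
      A = ε.transport (ThetaSetting.transportCocycle c h f₀).1 ⟨ε.ι (x : D.PiTemp), hgY⟩ := ⟨_, rfl⟩
  obtain ⟨A₁, hA₁⟩ : ∃ A : (ThetaOrbitData.ofEmbedding ε hC hS).DeltaTheta,
      A = ε.transport f₁.1 ⟨ε.ι (x : D.PiTemp), hgY⟩ := ⟨_, rfl⟩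
  have hp₁ : ξ₁ ⟨ε.ι (x : D.PiTemp), hgY, hgU⟩ ^ l = A₁ := by
    rw [hA₁]; exact hpow₁ ⟨ε.ι (x : D.PiTemp), hgY, hgU⟩
  have h3 : A₀ = A₁ * ((ThetaOrbitData.ofEmbedding ε hC hS).act (ε.ι (x : D.PiTemp)) d * d⁻¹) :=
    calc A₀ = ΓΘ (ε.transport f₀.1 ⟨Γ.symm (ε.ι (x : D.PiTemp)), hyY⟩) := by
          rw [hA₀]
          exact (ε.aut_transport_symm_apply hα h c ΓΘ hΓΘ f₀ ⟨ε.ι (x : D.PiTemp), hgY⟩ hyY).symm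
      _ = ΓΘ (ξ₀ ⟨Γ.symm (ε.ι (x : D.PiTemp)), hyU⟩ ^ l) := by
          exact congrArg ΓΘ (hpow₀ ⟨Γ.symm (ε.ι (x : D.PiTemp)), hyU⟩).symm
      _ = ΓΘ (ξ₀ ⟨Γ.symm (ε.ι (x : D.PiTemp)), hyU⟩) ^ l := map_pow ΓΘ _ _
      _ = (ξ₁ ⟨ε.ι (x : D.PiTemp), hgY, hgU⟩ * κ (ε.ι (x : D.PiTemp))) ^ l := by rw [hξg]
      _ = ξ₁ ⟨ε.ι (x : D.PiTemp), hgY, hgU⟩ ^ l * κ (ε.ι (x : D.PiTemp)) ^ l :=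
          Commute.mul_pow (hcomm _ _) l
      _ = A₁ * ((ThetaOrbitData.ofEmbedding ε hC hS).act (ε.ι (x : D.PiTemp)) d * d⁻¹) := by
          rw [hd, hp₁]
  -- back to `Δ_Θ` through `coeffOf`
  rw [hA₀, hA₁, ← hd₀] at h3
  change ε.coeffOf ((ThetaSetting.transportCocycle c h f₀).1 (ε.pull ⟨ε.ι (x : D.PiTemp), hgY⟩)) =
      ε.coeffOf (f₁.1 (ε.pull ⟨ε.ι (x : D.PiTemp), hgY⟩)) * _ at h3
  rw [hpull, ε.act_coeffOf hC hS] at h3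
  have hinv : ε.coeffOf d₀⁻¹ = (ε.coeffOf d₀)⁻¹ := by rw [← he, ← he, map_inv]
  have key : ε.coeffOf ((ThetaSetting.transportCocycle c h f₀).1 x) =
      ε.coeffOf (f₁.1 x * (MulAut.conjNormal (D.toTheta (x : D.PiTemp)) d₀ * d₀⁻¹)) := by
    rw [h3, ε.coeffOf_mul, ε.coeffOf_mul, hinv]
    rfl
  exact ε.coeffOf_injective key

end ThetaSetting.EtaleThetaData.DoubleUnderline.OrbitEmbedding

end Literature.AnabelianGeometry.EtaleTheta

end
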